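import Literature.Analysis.FluidPDE.CompressibleEulerImplosionCertEngine
import HarnessLib

/-!
# Two helper inequalities for Taylor-model certificates (`γ = 5/3` implosion, left barrier)

Used by the generated window files `CompressibleEulerImplosionLeftW*`: membership in a
symmetric rational box from an absolute-value bound, and the error of a square root against a
positive model value, `|√D − m| ≤ |D − m²| / m`.

[cite: BuckmasterCaolaboraGomezserrano2025, App. B]
-/

noncomputable section

namespace Literature.Analysis.FluidPDE

namespace BuckmasterCaolaboraGomezserrano2025

namespace Monatomic

namespace Cert

open Literature.Analysis.ValidatedNumerics NonemptyInterval

/-- Membership in the symmetric box `[−e, e]` from `|v| ≤ e`. [folklore] -/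
theorem mem_abs' {e : ℚ} (h0 : -e ≤ e) {v : ℝ} (h : |v| ≤ (e : ℝ)) :
    v ∈ ((⟨(-e, e), h0⟩ : NonemptyInterval ℚ).ratCast ℝ) :=
  mem_mk' _ (by have := abs_le.mp h; push_cast; exact this)

/-- `|√D − m| ≤ |D − m²| / m` for `m > 0`, `D ≥ 0`. [folklore] -/
theorem abs_sqrt_sub_le {D m ε : ℝ} (hm : 0 < m) (hD : 0 ≤ D) (h : |D - m ^ 2| ≤ ε) :
    |Real.sqrt D - m| ≤ ε / m := by
  have hs := Real.sqrt_nonneg D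
  have e : Real.sqrt D - m = (D - m ^ 2) / (Real.sqrt D + m) := by
    have hne : Real.sqrt D + m ≠ 0 := by positivity
    field_simp
    nlinarith [Real.sq_sqrt hD]
  rw [e, abs_div, abs_of_pos (by positivity : 0 < Real.sqrt D + m)]
  calc |D - m ^ 2| / (Real.sqrt D + m) ≤ |D - m ^ 2| / m := by
        apply div_le_div_of_nonneg_left (abs_nonneg _) hm; linarith
    _ ≤ ε / m := by apply div_le_div_of_nonneg_right h hm.le

end Cert

end Monatomic

end BuckmasterCaolaboraGomezserrano2025

end Literature.Analysis.FluidPDE
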